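import Summits.AnomalousDissipation.AnomalousDissipation.Theorems.SawtoothPulseCascadeK1LocalisedCascadeCornerTraceGeomSumNeg
import Summits.AnomalousDissipation.AnomalousDissipation.Theorems.SawtoothPulseCascadeK1LocalisedCascadeCornerTraceGeomTau

/-!
# K1loc — helper: THE ALL-ORDERS CORNER-TRACE BOUND ON ONE FIBRE OF A BOX WINDOW («CT-GEO» fibre packaging)

Helper file of the prover lane on the crux `K1LocalisedCascade` (stmt-AnomalousDissipation-19491), route
`SawtoothPulseCascade` (S-D fibre ledger, corner-trace track; finding F-p1g9-1, memo v15).  For the half-step ports: on a fibre `n`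
(lobe `|n|G`) of a box window (`|k₀| ≤ K`, `|n| ≥ n₀`, `K + L + D ≤ n₀G`, `K + 1 ≤ n₀G − Λ`) the scalar hypotheses of
`…CornerTraceGeomSum(Neg).cornerTraceGeom_sum_sq_le(_neg)` are discharged UNIFORMLY IN THE FIBRE: the trace scalars `τ_i` of
`…CornerTraceGeomTau.cornerTraceGeom_tau_le` at the bottom lobe `n₀G` serve every fibre (`cornerTraceGeom_weight_antitone`: the
weights decrease with the lobe), `σ_ξ` and `M_p` are the closed forms.  Statements `cornerTraceGeom_fibre_sq_le_pos/neg`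
(traces at the corners `(4r∓1)/(4N)`, resp. the reflected corners), and the bookkeeping lemma `sum_traces_le_mul` (a family of
trace bounds at `N` points sums to `≤ N·Θ`).  No definitions; nothing about the crux. [cite: Grafakos2014, Prop. 3.1.2 (5), §3.1.3] [problem: turb]
-/

-- `Summit.<Summit>.<Problem>`: single-conjunct summit, the duplicate namespace segment is deliberate.
set_option linter.dupNamespace false

noncomputable section

namespace Summit.AnomalousDissipation.AnomalousDissipation.Theorems.SawtoothPulseCascade.K1Window

open MeasureTheory Set Filter Topology Function Complex AddCircle
open scoped Real
open Literature.Analysis Literature.Analysis.FunctionSpaces Literature.Analysis.FunctionSpaces.Torus Literature.Analysis.FluidPDE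
open Literature.Analysis.FluidPDE.SawtoothCascade
open Summit.AnomalousDissipation.AnomalousDissipation.Theorems.SawtoothPulseCascade.K1Start

/-- **The corner-trace weights are antitone in the lobe**: for `|k| < λ₀ ≤ λ`, `Λ ≥ 0`,
`Φ_Λ^{(λ)}(k)Φ_i^{(λ)}(k)Λ^i ≤ Φ_Λ^{(λ₀)}(k)Φ_i^{(λ₀)}(k)Λ^i`. [folklore] -/
theorem cornerTraceGeom_weight_antitone (p i : ℕ) {Λ lam₀ lam : ℝ} (hΛ : 0 ≤ Λ) {k : ℤ} (hk : |(k : ℝ)| < lam₀)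
    (hlam : lam₀ ≤ lam) :
    (∑ i' ∈ Finset.range p, Λ ^ i' * (1 / (lam + k) ^ (i' + 1) + 1 / (lam - k) ^ (i' + 1))) *
        (1 / (lam + k) ^ (i + 1) + 1 / (lam - k) ^ (i + 1)) * Λ ^ i ≤
      (∑ i' ∈ Finset.range p, Λ ^ i' * (1 / (lam₀ + k) ^ (i' + 1) + 1 / (lam₀ - k) ^ (i' + 1))) *
        (1 / (lam₀ + k) ^ (i + 1) + 1 / (lam₀ - k) ^ (i + 1)) * Λ ^ i := by
  have hk1 := le_abs_self ((k : ℤ) : ℝ); have hk2 := neg_abs_le ((k : ℤ) : ℝ)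
  have h0a : 0 < lam₀ + k := by linarith
  have h0b : 0 < lam₀ - k := by linarith
  have hmono : ∀ m : ℕ, 1 / (lam + k) ^ m + 1 / (lam - k) ^ m ≤ 1 / (lam₀ + k) ^ m + 1 / (lam₀ - k) ^ m := fun m =>
    add_le_add (one_div_le_one_div_of_le (pow_pos h0a m) (pow_le_pow_left₀ h0a.le (by linarith) m))
      (one_div_le_one_div_of_le (pow_pos h0b m) (pow_le_pow_left₀ h0b.le (by linarith) m))
  have hnn : ∀ m : ℕ, 0 ≤ 1 / (lam + k) ^ m + 1 / (lam - k) ^ m := fun m => by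
    have : 0 < lam + k := by linarith
    have : 0 < lam - k := by linarith
    positivity
  have hnn0 : ∀ m : ℕ, 0 ≤ 1 / (lam₀ + k) ^ m + 1 / (lam₀ - k) ^ m := fun m => by positivity
  have hS : ∑ i' ∈ Finset.range p, Λ ^ i' * (1 / (lam + k) ^ (i' + 1) + 1 / (lam - k) ^ (i' + 1)) ≤
      ∑ i' ∈ Finset.range p, Λ ^ i' * (1 / (lam₀ + k) ^ (i' + 1) + 1 / (lam₀ - k) ^ (i' + 1)) :=
    Finset.sum_le_sum fun i' _ => mul_le_mul_of_nonneg_left (hmono _) (pow_nonneg hΛ _)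
  have hS0 : 0 ≤ ∑ i' ∈ Finset.range p, Λ ^ i' * (1 / (lam₀ + k) ^ (i' + 1) + 1 / (lam₀ - k) ^ (i' + 1)) :=
    Finset.sum_nonneg fun i' _ => mul_nonneg (pow_nonneg hΛ _) (hnn0 _)
  exact mul_le_mul_of_nonneg_right (mul_le_mul hS (hmono _) (hnn _) hS0) (pow_nonneg hΛ _)

/-- **Transport of the trace scalars from the bottom lobe to a fibre**: if `τ_i` bound the weight sums over the residue classes of
`[−K, K]` at the lobe `λ₀` (`K + 1 ≤ λ₀ − Λ`), then they bound them over any `W ⊆ [−K, K]` at every lobe `λ ≥ λ₀`. [folklore] -/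
theorem cornerTraceGeom_tau_transport {N : ℕ} (p : ℕ) {Λ : ℝ} (hΛ : 0 ≤ Λ) {K lam₀ lam : ℕ}
    (hedge : (K : ℝ) + 1 ≤ (lam₀ : ℝ) - Λ) (hlam : lam₀ ≤ lam) {τ : ℕ → ℝ}
    (hτ : ∀ i ∈ Finset.range p, ∀ ρ : ℤ,
      ∑ k ∈ (Finset.Icc (-(K : ℤ)) K).filter (fun k => (N : ℤ) ∣ k - ρ),
        (∑ i' ∈ Finset.range p, Λ ^ i' * (1 / ((lam₀ : ℝ) + k) ^ (i' + 1) + 1 / ((lam₀ : ℝ) - k) ^ (i' + 1))) *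
          (1 / ((lam₀ : ℝ) + k) ^ (i + 1) + 1 / ((lam₀ : ℝ) - k) ^ (i + 1)) * Λ ^ i ≤ τ i)
    (W : Finset ℤ) (hW : ∀ k ∈ W, |k| ≤ (K : ℤ)) :
    ∀ i ∈ Finset.range p, ∀ ρ : ℤ,
      ∑ k ∈ W.filter (fun k => (N : ℤ) ∣ k - ρ),
        (∑ i' ∈ Finset.range p, Λ ^ i' * (1 / ((lam : ℝ) + k) ^ (i' + 1) + 1 / ((lam : ℝ) - k) ^ (i' + 1))) *
          (1 / ((lam : ℝ) + k) ^ (i + 1) + 1 / ((lam : ℝ) - k) ^ (i + 1)) * Λ ^ i ≤ τ i := by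
  intro i hi ρ
  have hsub : W.filter (fun k => (N : ℤ) ∣ k - ρ) ⊆ (Finset.Icc (-(K : ℤ)) K).filter (fun k => (N : ℤ) ∣ k - ρ) := by
    intro k hk
    obtain ⟨hkW, hkd⟩ := Finset.mem_filter.mp hk
    exact Finset.mem_filter.mpr ⟨Finset.mem_Icc.mpr (abs_le.mp (hW k hkW)), hkd⟩
  have hlamr : (lam₀ : ℝ) ≤ lam := by exact_mod_cast hlam
  refine le_trans ?_ (hτ i hi ρ)
  refine le_trans (Finset.sum_le_sum fun k hk => ?_) (Finset.sum_le_sum_of_subset_of_nonneg hsub fun k hk _ => ?_)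
  · have hkK : |((k : ℤ) : ℝ)| ≤ K := by
      rw [← Int.cast_abs]; exact_mod_cast hW k (Finset.mem_filter.mp hk).1
    exact cornerTraceGeom_weight_antitone p i hΛ (by linarith) hlamr
  · obtain ⟨hkI, -⟩ := Finset.mem_filter.mp hk
    have hk' : |((k : ℤ) : ℝ)| ≤ K := by rw [← Int.cast_abs]; exact_mod_cast abs_le.mpr (Finset.mem_Icc.mp hkI)
    have := le_abs_self ((k : ℤ) : ℝ); have := neg_abs_le ((k : ℤ) : ℝ)
    have h1 : 0 < (lam₀ : ℝ) + k := by linarith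
    have h2 : 0 < (lam₀ : ℝ) - k := by linarith
    refine mul_nonneg (mul_nonneg (Finset.sum_nonneg fun i' _ => ?_) ?_) (pow_nonneg hΛ _) <;> positivity

/-- **A family of trace bounds at `N` evaluation points sums to `≤ N·Θ`** (the traces `T(n,y) = Σ_l d(l,n) e^{2πily}` bounded by
`Θ` in `Σ_n`, uniformly in `y`). [folklore] -/
theorem sum_traces_le_mul {N : ℕ} (F' S : Finset ℤ) (d : ℤ → ℤ → ℂ) {Θ : ℝ}
    (hΘ : ∀ y : ℝ, ∑ n ∈ F', ‖∑ l ∈ S, d l n * Complex.exp (2 * π * I * l * y)‖ ^ 2 ≤ Θ)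
    (w : ℕ → ℂ) (hw : ∀ r, ∃ y : ℝ, (y : ℂ) = w r) :
    ∑ n ∈ F', ∑ r ∈ Finset.range N, ‖∑ l ∈ S, d l n * Complex.exp (2 * π * I * l * w r)‖ ^ 2 ≤ N * Θ := by
  rw [Finset.sum_comm]
  calc ∑ r ∈ Finset.range N, ∑ n ∈ F', ‖∑ l ∈ S, d l n * Complex.exp (2 * π * I * l * w r)‖ ^ 2
      ≤ ∑ r ∈ Finset.range N, Θ :=
        Finset.sum_le_sum fun r _ => by obtain ⟨y, hy⟩ := hw r; rw [← hy]; exact hΘ y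
    _ = N * Θ := by rw [Finset.sum_const, Finset.card_range, nsmul_eq_mul]

set_option maxHeartbeats 800000 in
/-- **ONE FIBRE OF A BOX WINDOW, POSITIVE LOBE**: `N ≥ 1`, exact `N`-tooth chirp with lobe `λ ∈ ℕ`, coefficients on `S ⊆ [−L, L]`,
window `W ⊆ [−K, K]` with `|k| + L + D ≤ λ`, bottom lobe `λ₀ ≤ λ` with `K + 1 ≤ λ₀ − Λ`, trace scalars `τ_i` at `λ₀` (from
`…CornerTraceGeomTau.cornerTraceGeom_tau_le`), `p ≥ 1`, `Λ > 0`, `ε > 0`: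
`Σ_{k∈W} |Σ_l c_l ĝ₀(k−l)|² ≤ (1+ε)(N/2π²) Σ_{i<p} (τ_i/Λ^{2i})(Tr_i⁻ + Tr_i⁺) + (1+ε⁻¹)(N²/π²)·σ_ξ·M_p·Σ|c_l|²`
with `σ_ξ = (4/D²)(1/S^{2p} + 1/(NS^{2p−1}))`, `S = D + L`, `M_p = (2L/N+1)L^{2p}`. [cite: Grafakos2014, Prop. 3.1.2 (5), §3.1.3] -/
theorem cornerTraceGeom_fibre_sq_le_pos {N : ℕ} (hN : 0 < N) {L₂ : ℕ} {g₀ : UnitAddCircle → ℂ}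
    (hg₀ : ∀ t : ℝ, g₀ (t : UnitAddCircle) =
      Complex.exp (-(2 * π * I * ((L₂ : ℤ) : ℂ) * ((tri (2 * π * N * t) / (2 * π * N) : ℝ) : ℂ))))
    (c : ℤ → ℂ) (S : Finset ℤ) {L D K lam₀ : ℕ} (hD : 0 < D) (hS : ∀ l ∈ S, |l| ≤ L)
    (W : Finset ℤ) (hW : ∀ k ∈ W, |k| + L + D ≤ (L₂ : ℤ)) (hWK : ∀ k ∈ W, |k| ≤ (K : ℤ)) (hlam : lam₀ ≤ L₂)
    {p : ℕ} (hp : 1 ≤ p) {Λ ε : ℝ} (hΛ : 0 < Λ) (hε : 0 < ε) (hedge : (K : ℝ) + 1 ≤ (lam₀ : ℝ) - Λ) {τ : ℕ → ℝ}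
    (hτ : ∀ i ∈ Finset.range p, ∀ ρ : ℤ,
      ∑ k ∈ (Finset.Icc (-(K : ℤ)) K).filter (fun k => (N : ℤ) ∣ k - ρ),
        (∑ i' ∈ Finset.range p, Λ ^ i' * (1 / ((lam₀ : ℝ) + k) ^ (i' + 1) + 1 / ((lam₀ : ℝ) - k) ^ (i' + 1))) *
          (1 / ((lam₀ : ℝ) + k) ^ (i + 1) + 1 / ((lam₀ : ℝ) - k) ^ (i + 1)) * Λ ^ i ≤ τ i) :
    ∑ k ∈ W, ‖∑ l ∈ S, c l * fourierCoeff g₀ (k - l)‖ ^ 2 ≤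
      (1 + ε) * ((N : ℝ) / (2 * π ^ 2)) * ∑ i ∈ Finset.range p, τ i / Λ ^ (2 * i) *
          (∑ r ∈ Finset.range N, ‖∑ l ∈ S, c l * (l : ℂ) ^ i * Complex.exp (2 * π * I * l * ((4 * (r : ℝ) - 1) / (4 * N)))‖ ^ 2 +
            ∑ r ∈ Finset.range N, ‖∑ l ∈ S, c l * (l : ℂ) ^ i * Complex.exp (2 * π * I * l * ((4 * (r : ℝ) + 1) / (4 * N)))‖ ^ 2) +
        (1 + ε⁻¹) * ((N : ℝ) ^ 2 / π ^ 2) * (4 / (D : ℝ) ^ 2 * (1 / ((D : ℝ) + L) ^ (2 * p) + 1 / (N * ((D : ℝ) + L) ^ (2 * p - 1)))) *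
          ((2 * (L : ℝ) / N + 1) * (L : ℝ) ^ (2 * p)) * ∑ l ∈ S, ‖c l‖ ^ 2 :=
  cornerTraceGeom_sum_sq_le hN hg₀ c S hD hS W hW p hΛ hε
    (cornerTraceGeom_tau_transport p hΛ.le hedge hlam hτ W hWK)
    (fun ρ => cornerTraceGeom_sigma_le hN hD W hW hp ρ) (fun k => cornerTraceGeom_moment_le hN S hS p k)

set_option maxHeartbeats 800000 in
/-- **ONE FIBRE OF A BOX WINDOW, NEGATIVE LOBE**: the same with the chirp of lobe `−λ` and the corner traces at the reflected corners.
[cite: Grafakos2014, Prop. 3.1.2 (5), §3.1.3] -/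
theorem cornerTraceGeom_fibre_sq_le_neg {N : ℕ} (hN : 0 < N) {L₂ : ℕ} {g₀ : UnitAddCircle → ℂ}
    (hg₀ : ∀ t : ℝ, g₀ (t : UnitAddCircle) =
      Complex.exp (-(2 * π * I * ((-(L₂ : ℤ) : ℤ) : ℂ) * ((tri (2 * π * N * t) / (2 * π * N) : ℝ) : ℂ))))
    (c : ℤ → ℂ) (S : Finset ℤ) {L D K lam₀ : ℕ} (hD : 0 < D) (hS : ∀ l ∈ S, |l| ≤ L)
    (W : Finset ℤ) (hW : ∀ k ∈ W, |k| + L + D ≤ (L₂ : ℤ)) (hWK : ∀ k ∈ W, |k| ≤ (K : ℤ)) (hlam : lam₀ ≤ L₂)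
    {p : ℕ} (hp : 1 ≤ p) {Λ ε : ℝ} (hΛ : 0 < Λ) (hε : 0 < ε) (hedge : (K : ℝ) + 1 ≤ (lam₀ : ℝ) - Λ) {τ : ℕ → ℝ}
    (hτ : ∀ i ∈ Finset.range p, ∀ ρ : ℤ,
      ∑ k ∈ (Finset.Icc (-(K : ℤ)) K).filter (fun k => (N : ℤ) ∣ k - ρ),
        (∑ i' ∈ Finset.range p, Λ ^ i' * (1 / ((lam₀ : ℝ) + k) ^ (i' + 1) + 1 / ((lam₀ : ℝ) - k) ^ (i' + 1))) *
          (1 / ((lam₀ : ℝ) + k) ^ (i + 1) + 1 / ((lam₀ : ℝ) - k) ^ (i + 1)) * Λ ^ i ≤ τ i) :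
    ∑ k ∈ W, ‖∑ l ∈ S, c l * fourierCoeff g₀ (k - l)‖ ^ 2 ≤
      (1 + ε) * ((N : ℝ) / (2 * π ^ 2)) * ∑ i ∈ Finset.range p, τ i / Λ ^ (2 * i) *
          (∑ r ∈ Finset.range N, ‖∑ l ∈ S, c l * (l : ℂ) ^ i *
              Complex.exp (2 * π * I * l * (-((4 * (r : ℝ) - 1) / (4 * N))))‖ ^ 2 +
            ∑ r ∈ Finset.range N, ‖∑ l ∈ S, c l * (l : ℂ) ^ i *
              Complex.exp (2 * π * I * l * (-((4 * (r : ℝ) + 1) / (4 * N))))‖ ^ 2) +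
        (1 + ε⁻¹) * ((N : ℝ) ^ 2 / π ^ 2) * (4 / (D : ℝ) ^ 2 * (1 / ((D : ℝ) + L) ^ (2 * p) + 1 / (N * ((D : ℝ) + L) ^ (2 * p - 1)))) *
          ((2 * (L : ℝ) / N + 1) * (L : ℝ) ^ (2 * p)) * ∑ l ∈ S, ‖c l‖ ^ 2 :=
  cornerTraceGeom_sum_sq_le_neg hN hg₀ c S hD hS W hW p hΛ hε
    (cornerTraceGeom_tau_transport p hΛ.le hedge hlam hτ W hWK)
    (fun ρ => cornerTraceGeom_sigma_le hN hD W hW hp ρ) (fun k => cornerTraceGeom_moment_le hN S hS p k)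

end Summit.AnomalousDissipation.AnomalousDissipation.Theorems.SawtoothPulseCascade.K1Window
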